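import Literature.Geometry.Kaehler.ComplexTorusOfExponential
import Literature.Geometry.Kaehler.LieAddGroupExponentialComplex
import Literature.NumberTheory.Transcendental.AbelianVarietyAnalyticLieGroup
import HarnessLib

/-!
# A connected compact commutative complex Lie group is a complex torus (Lange–Birkenhake Lemma 1.1.2)

Topic `Geometry/Kaehler`; namespace `Literature.Geometry.Kaehler`. Theorems only; no definition, no
named fact.

[LangeBirkenhake1992] Ch. 1 §1 **Lemma 1.1.2**: «Any connected compact complex Lie group `X` of
dimension `g` is a complex torus.» (proof: «`X` is abelian … the exponential map `exp : ℂ^g → X`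
is a surjective homomorphism with discrete kernel … `X ≅ ℂ^g / ker exp`»); [MumfordAV1970] §1
(1)–(2); [Shimura1998] §3.1 («analytic coordinate-system» of a complex torus). This file is the
COMPOSITION of the tree's pieces, for a COMMUTATIVE compact connected complex Lie group `G`
modelled on a finite-dimensional complex normed space `E` (`[AddCommGroup G] [LieAddGroup 𝓘(ℂ, E) ω G]`;
commutativity of every compact connected complex Lie group is the separate tree theorem
`Literature.Geometry.Manifold.LieAddGroup.add_comm_of_compactSpace`):

* the exponential map OF RECORD `lieAddExp : E → G` of an additive Lie group
  (`Literature/Geometry/Manifold/LieAddGroupExponential.lean`, Lee 2012 Thm. 20.1 / Prop. 20.8 /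
  Problem 20-8 / 21-20: `lieAddExp_add`, `exists_nhds_injOn_lieAddExp`, `isOpenMap_lieAddExp`,
  `lieAddExp_surjective`), for the real Lie group structure underlying the complex one
  (`lieAddGroup_real_of_complex`) and holomorphic (`mdifferentiable_complex_lieAddExp'`,
  `Literature/Geometry/Kaehler/LieAddGroupExponentialComplex.lean`; upgraded to `C^ω` by
  `Transcendental.contMDiff_omega_of_mdifferentiable`);
* the abstract torus theorem `torus_of_exp` (`ComplexTorusOfExponential.lean`): such an
  exponential exhibits `G` as `ComplexTorus Φ` for a real frame `Φ : ℝ^ι ≃L[ℝ] E` of `ker exp`.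

Results: `exists_complexTorus_addEquiv` (general `E`), and the `E := ℂⁿ` instance
`langeBirkenhake_lemma_1_1_2_weak` — VERBATIM the hypothesis `hLB` of
`HodgeTheory.deligneMilne1982_Thm_6_20_full_of_lieAddGroup` /
`Transcendental.complexAbelianVariety_torusUniformised_of_lieAddGroup` (cell `pub-hodgecm2`, row D1-3
of the LIT-FANOUT plan; with it Riemann's theorem `DeligneMilne1982_Thm_6_20_full` becomes a
theorem, filed separately as `AbelianVarietyHodgeFullnessHolds.lean`).

## References

* H. Lange, Ch. Birkenhake, *Complex Abelian Varieties*, Grundlehren 302 (1992), Ch. 1 §1,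
  Lemma 1.1.2. [LangeBirkenhake1992]
* D. Mumford, *Abelian Varieties* (1970), §1 (1)–(2). [MumfordAV1970]
* J. M. Lee, *Introduction to Smooth Manifolds*, 2nd ed. (2012), Thm. 20.1, Prop. 20.8,
  Problems 20-8, 21-20. [LeeSmoothManifolds2013]
-/

noncomputable section

open Set Function
open scoped Topology Manifold ContDiff

namespace Literature.Geometry.Kaehler

open Literature.Geometry.Manifold
open Literature.NumberTheory.Transcendental (contMDiff_omega_of_mdifferentiable)

universe u v

/-- **The exponential map of a commutative complex Lie group, packaged**: for a
commutative complex Lie group `G` (Hausdorff, modelled on the finite-dimensional complex space `E`)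
the exponential map of record `lieAddExp` is an additive homomorphism `E →+ G` which is `C^ω`
(holomorphic), open, injective near `0`, and surjective when `G` is connected
(Lee 2012 Prop. 20.8, Problems 20-8 / 21-20; holomorphy: Lange–Birkenhake §1.1).
[cite: LeeSmoothManifolds2013, Prop. 20.8 and Problem 21-20] [cite: LangeBirkenhake1992, Ch. 1 §1 Lemma 1.1.2 (proof)] -/
theorem exists_addMonoidHom_exp {E : Type u} [NormedAddCommGroup E] [NormedSpace ℂ E]
    [FiniteDimensional ℂ E] {G : Type v} [AddCommGroup G] [TopologicalSpace G] [T2Space G]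
    [ChartedSpace E G] [LieAddGroup 𝓘(ℂ, E) ω G] :
    ∃ exp : E →+ G, ContMDiff 𝓘(ℂ, E) 𝓘(ℂ, E) ω exp ∧ IsOpenMap exp ∧
      (∃ U ∈ 𝓝 (0 : E), U.InjOn exp) ∧ (ConnectedSpace G → Surjective exp) := by
  haveI : CompleteSpace E := FiniteDimensional.complete ℂ E
  haveI : LieAddGroup 𝓘(ℝ, E) ∞ G := lieAddGroup_real_of_complex (E := E) (G := G)
  refine ⟨AddMonoidHom.mk' (fun v : E => lieAddExp (I := 𝓘(ℝ, E)) (G := G) v)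
    (fun v w => lieAddExp_add (I := 𝓘(ℝ, E)) (G := G) v w), ?_, ?_, ?_, ?_⟩
  · exact contMDiff_omega_of_mdifferentiable (mdifferentiable_complex_lieAddExp (E := E) (G := G))
  · exact isOpenMap_lieAddExp (I := 𝓘(ℝ, E)) (G := G)
  · exact exists_nhds_injOn_lieAddExp (I := 𝓘(ℝ, E)) (G := G)
  · intro _
    exact lieAddExp_surjective (I := 𝓘(ℝ, E)) (G := G)

/-- **Lange–Birkenhake Lemma 1.1.2 (commutative form, any model space)**: a connected compact
commutative complex Lie group `G` modelled on `E` is a complex torus — there are a real frame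
`Φ : ℝ^ι ≃L[ℝ] E` and a group isomorphism `ComplexTorus Φ ≃+ G` which is a homeomorphism and
holomorphic. [cite: LangeBirkenhake1992, Ch. 1 §1 Lemma 1.1.2] -/
theorem exists_complexTorus_addEquiv {E : Type u} [NormedAddCommGroup E] [NormedSpace ℂ E]
    [FiniteDimensional ℂ E] {G : Type v} [AddCommGroup G] [TopologicalSpace G] [T2Space G]
    [CompactSpace G] [ConnectedSpace G] [ChartedSpace E G] [LieAddGroup 𝓘(ℂ, E) ω G] :
    ∃ (ι : Type u) (_ : Fintype ι) (Φ : (ι → ℝ) ≃L[ℝ] E) (e : ComplexTorus Φ ≃+ G),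
      IsHomeomorph e ∧ MDifferentiable 𝓘(ℂ, E) 𝓘(ℂ, E) e ∧ ContMDiff 𝓘(ℂ, E) 𝓘(ℂ, E) ω e := by
  obtain ⟨exp, hhol, hopen, hinj, hsurj⟩ := exists_addMonoidHom_exp (E := E) (G := G)
  exact torus_of_exp exp hhol hopen hinj (hsurj inferInstance)

/-- **Lange–Birkenhake Lemma 1.1.2, weak `ℂⁿ` form** — exactly the hypothesis `hLB` of
`HodgeTheory.deligneMilne1982_Thm_6_20_full_of_lieAddGroup` /
`Transcendental.complexAbelianVariety_torusUniformised_of_lieAddGroup`: every connected compact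
commutative complex Lie group modelled on `ℂⁿ` is `ComplexTorus Φ`, `Φ : ℝ^ι ≃L[ℝ] ℂⁿ`, by a group
isomorphism which is a homeomorphism and complex-differentiable.
[cite: LangeBirkenhake1992, Ch. 1 §1 Lemma 1.1.2] -/
theorem langeBirkenhake_lemma_1_1_2_weak (n : ℕ) (G : Type) [AddCommGroup G] [TopologicalSpace G]
    [T2Space G] [CompactSpace G] [ConnectedSpace G] [ChartedSpace (Fin n → ℂ) G]
    [LieAddGroup 𝓘(ℂ, Fin n → ℂ) ω G] :
    ∃ (ι : Type) (_ : Fintype ι) (Φ : (ι → ℝ) ≃L[ℝ] (Fin n → ℂ)) (e : ComplexTorus Φ ≃+ G),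
      IsHomeomorph e ∧ MDifferentiable 𝓘(ℂ, Fin n → ℂ) 𝓘(ℂ, Fin n → ℂ) e := by
  obtain ⟨ι, _, Φ, e, he, hed, -⟩ := exists_complexTorus_addEquiv (E := Fin n → ℂ) (G := G)
  exact ⟨ι, inferInstance, Φ, e, he, hed⟩

end Literature.Geometry.Kaehler

end
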